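import Mathlib
import Summits.ValiantsHypothesis.ValiantsHypothesis.Theorems.FifoMatchingNFPolytopeQueueGridGadgetCounts
import HarnessLib

/-!
# Route `FifoMatching`, item `NFPolytopeQuasiPolyXC` (K1, stmt-26254), line `queue_grid_face`, INPUT (A):
# the arcs of a design — every push `x` is popped at `partner X x` (so designs are supported on `E′`)

For a push `x` of the design word of `X`, the designed closer `partner X x` is a pop, it is an allowed arc
(`adj x (partner X x)`), and exactly `cU X x` pops precede it (`partner_spec`); hence the FIFO pairing pairs them:
`design d X x.toFin = (partner X x).toFin` (`design_toFin`), every arc of a design lies in `allowed r d`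
(`design_mem_allowed`), and the pattern coordinates of a design read the bits (`design_slot_uSlot₁`, `design_slot_uSlot₂`).
Honest framing: bookkeeping for input (A); nothing here bears on K1 or VP ≠ VNP.
-/

noncomputable section

-- Sub = Summit single-conjunct layout: the duplicated namespace component is mandated by the tree.
set_option linter.dupNamespace false

namespace Summit.ValiantsHypothesis.ValiantsHypothesis.Theorems.FifoMatching.NFPolytopeQuasiPolyXC.QueueGridFace

open Finset Literature.Computability.AlgebraicComplexity
open Summit.ValiantsHypothesis.ValiantsHypothesis.Theorems.FifoMatching.NNMonotoneHard

namespace QPos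

variable {r d : ℕ} (X : Fin r × Fin r → Bool)

/-! ### Slot arithmetic -/

/-- value of the first-pop slot -/
@[simp] theorem dSlot₁_val (b : Bool) : (dSlot₁ b).val = 2 * b.toNat := by cases b <;> rfl
/-- value of the second-pop slot -/
@[simp] theorem dSlot₂_val (b : Bool) : (dSlot₂ b).val = 2 * b.toNat + 1 := by cases b <;> rfl
/-- value of the first-push slot -/
@[simp] theorem uSlot₁_val (b : Bool) : (uSlot₁ b).val = 2 * (!b).toNat := by cases b <;> rfl
/-- value of the second-push slot -/
@[simp] theorem uSlot₂_val (b : Bool) : (uSlot₂ b).val = 2 * (!b).toNat + 1 := by cases b <;> rfl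
/-- pushes before the first pop -/
@[simp] theorem uw_dSlot₁ (b : Bool) : uw b (2 * b.toNat) = 2 * b.toNat := by cases b <;> rfl
/-- pushes before the second pop -/
@[simp] theorem uw_dSlot₂ (b : Bool) : uw b (2 * b.toNat + 1) = 2 * b.toNat := by cases b <;> rfl
/-- pushes before the first push -/
@[simp] theorem uw_uSlot₁ (b : Bool) : uw b (2 * (!b).toNat) = 0 := by cases b <;> rfl
/-- pushes before the second push -/
@[simp] theorem uw_uSlot₂ (b : Bool) : uw b (2 * (!b).toNat + 1) = 1 := by cases b <;> rfl
/-- the pops of a window are pops -/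
@[simp] theorem isU_dSlot₁ (s i : Fin r) : isU X (slot s i (dSlot₁ (X (s, i))) : QPos r d) = false := by
  cases h : X (s, i) <;> simp [isU, dSlot₁, h]
/-- the pops of a window are pops -/
@[simp] theorem isU_dSlot₂ (s i : Fin r) : isU X (slot s i (dSlot₂ (X (s, i))) : QPos r d) = false := by
  cases h : X (s, i) <;> simp [isU, dSlot₂, h]
/-- the pushes of a window are pushes -/
@[simp] theorem isU_uSlot₁ (s i : Fin r) : isU X (slot s i (uSlot₁ (X (s, i))) : QPos r d) = true := by
  cases h : X (s, i) <;> simp [isU, uSlot₁, h]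
/-- the pushes of a window are pushes -/
@[simp] theorem isU_uSlot₂ (s i : Fin r) : isU X (slot s i (uSlot₂ (X (s, i))) : QPos r d) = true := by
  cases h : X (s, i) <;> simp [isU, uSlot₂, h]

/-- A push slot of even index is the first push `uSlot₁`. -/
theorem eq_uSlot₁_of_isU {s i : Fin r} {t : Fin 4} (hu : isU X (slot s i t : QPos r d) = true) (ht : t.val % 2 = 0) :
    t = uSlot₁ (X (s, i)) := by
  apply Fin.ext
  have := t.isLt
  cases h : X (s, i) <;> simp only [isU, h] at hu <;> simp only [uSlot₁_val] <;> simp at hu ⊢ <;> omega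

/-- A push slot of odd index is the second push `uSlot₂`. -/
theorem eq_uSlot₂_of_isU {s i : Fin r} {t : Fin 4} (hu : isU X (slot s i t : QPos r d) = true) (ht : t.val % 2 = 1) :
    t = uSlot₂ (X (s, i)) := by
  apply Fin.ext
  have := t.isLt
  cases h : X (s, i) <;> simp only [isU, h] at hu <;> simp only [uSlot₂_val] <;> simp at hu ⊢ <;> omega

/-! ### Equations of `partner` -/

section Partner
variable (s i : Fin r)

/-- preamble letter `2i` is popped first in window `(0, i)` -/
theorem partner_pre_even (j : Fin (2 * r + 1)) (h : j.val / 2 < r) (he : j.val % 2 = 0) :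
    partner X (pre j : QPos r d) = slot ⟨0, by omega⟩ ⟨_, h⟩ (dSlot₁ (X (⟨0, by omega⟩, ⟨_, h⟩))) := by
  show dite _ _ _ = _; rw [dif_pos h, if_pos he]

/-- preamble letter `2i+1` is popped second in window `(0, i)` -/
theorem partner_pre_odd (j : Fin (2 * r + 1)) (h : j.val / 2 < r) (he : j.val % 2 ≠ 0) :
    partner X (pre j : QPos r d) = slot ⟨0, by omega⟩ ⟨_, h⟩ (dSlot₂ (X (⟨0, by omega⟩, ⟨_, h⟩))) := by
  show dite _ _ _ = _; rw [dif_pos h, if_neg he]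

/-- the last preamble letter is popped by the frame `D` of stretch `0` -/
theorem partner_pre_last (j : Fin (2 * r + 1)) (h : ¬ j.val / 2 < r) (hr : 0 < r) :
    partner X (pre j : QPos r d) = frD ⟨0, hr⟩ := by
  show dite _ _ _ = _; rw [dif_neg h, dif_pos hr]

/-- degenerate `r = 0`: the one preamble letter is popped by the one postamble letter -/
theorem partner_pre_last_zero (j : Fin (2 * r + 1)) (h : ¬ j.val / 2 < r) (hr : ¬ 0 < r) :
    partner X (pre j : QPos r d) = post ⟨0, by omega⟩ := by
  show dite _ _ _ = _; rw [dif_neg h, dif_neg hr]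

/-- the frame `U` of stretch `s` is popped first in window `(s+1, 0)` -/
theorem partner_frU (h : s.val + 1 < r) :
    partner X (frU s : QPos r d) = slot ⟨_, h⟩ ⟨0, by omega⟩ (dSlot₁ (X (⟨_, h⟩, ⟨0, by omega⟩))) := dif_pos h

/-- the frame `U` of the last stretch is popped by the first postamble letter -/
theorem partner_frU_last (h : ¬ s.val + 1 < r) : partner X (frU s : QPos r d) = post ⟨0, by omega⟩ := dif_neg h

/-- the first push of window `(s, i)` is popped second in window `(s+1, i)` -/
theorem partner_slot_even (t : Fin 4) (ht : t.val % 2 = 0) (h : s.val + 1 < r) :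
    partner X (slot s i t : QPos r d) = slot ⟨_, h⟩ i (dSlot₂ (X (⟨_, h⟩, i))) := by
  show ite _ _ _ = _; rw [if_pos ht, dif_pos h]

/-- the first push of window `(r-1, i)` is popped by postamble letter `2i+1` -/
theorem partner_slot_even_last (t : Fin 4) (ht : t.val % 2 = 0) (h : ¬ s.val + 1 < r) :
    partner X (slot s i t : QPos r d) = post ⟨2 * i.val + 1, by have := i.isLt; omega⟩ := by
  show ite _ _ _ = _; rw [if_pos ht, dif_neg h]

/-- the second push of window `(s, i)` is popped first in window `(s+1, i+1)` -/
theorem partner_slot_odd (t : Fin 4) (ht : t.val % 2 ≠ 0) (h : s.val + 1 < r) (h₂ : i.val + 1 < r) :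
    partner X (slot s i t : QPos r d) = slot ⟨_, h⟩ ⟨_, h₂⟩ (dSlot₁ (X (⟨_, h⟩, ⟨_, h₂⟩))) := by
  show ite _ _ _ = _; rw [if_neg ht, dif_pos h, dif_pos h₂]

/-- the second push of window `(s, r-1)` is popped by the frame `D` of stretch `s+1` -/
theorem partner_slot_odd_frD (t : Fin 4) (ht : t.val % 2 ≠ 0) (h : s.val + 1 < r) (h₂ : ¬ i.val + 1 < r) :
    partner X (slot s i t : QPos r d) = frD ⟨_, h⟩ := by
  show ite _ _ _ = _; rw [if_neg ht, dif_pos h, dif_neg h₂]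

/-- the second push of window `(r-1, i)` is popped by postamble letter `2i+2` -/
theorem partner_slot_odd_last (t : Fin 4) (ht : t.val % 2 ≠ 0) (h : ¬ s.val + 1 < r) :
    partner X (slot s i t : QPos r d) = post ⟨2 * i.val + 2, by have := i.isLt; omega⟩ := by
  show ite _ _ _ = _; rw [if_neg ht, dif_neg h]

/-- padding letter `2u` is popped by padding letter `2u+1` -/
theorem partner_pad (j : Fin (2 * d)) (h : j.val + 1 < 2 * d) : partner X (pad j : QPos r d) = pad ⟨_, h⟩ := dif_pos h

end Partner

/-! ### The designed closer of a push: a pop, an allowed arc, and its pop-rank is the push-rank -/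

/-- **Specification of `partner`.**  For a push `x` of the design word of `X`: `partner X x` is a pop, `x → partner X x` is
an allowed arc of layout B, and the number of pops before `partner X x` (which is its position minus the pushes before
it) equals the number `cU X x` of pushes before `x`. -/
theorem partner_spec (x : QPos r d) (hx : isU X x = true) :
    isU X (partner X x) = false ∧ adj x (partner X x) = true ∧
      cU X (partner X x) + cU X x = (partner X x).toNat := by
  have hsq := sq_eq r
  cases x with
  | pre j =>
    have hj := j.isLt
    by_cases h : j.val / 2 < r
    · by_cases he : j.val % 2 = 0
      · rw [partner_pre_even X j h he]
        refine ⟨isU_dSlot₁ X _ _, ?_, ?_⟩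
        · simp [adj, adjV, vc]; omega
        · simp only [cU, toNat, dSlot₁_val, uw_dSlot₁]; omega
      · rw [partner_pre_odd X j h he]
        refine ⟨isU_dSlot₂ X _ _, ?_, ?_⟩
        · simp [adj, adjV, vc]; omega
        · simp only [cU, toNat, dSlot₂_val, uw_dSlot₂]; omega
    · by_cases hr : 0 < r
      · rw [partner_pre_last X j h hr]
        refine ⟨rfl, ?_, ?_⟩
        · simp [adj, adjV, vc]; omega
        · simp only [cU, toNat]; omega
      · rw [partner_pre_last_zero X j h hr]
        have hr0 : r = 0 := by omega
        subst hr0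
        refine ⟨rfl, ?_, ?_⟩
        · simp [adj, adjV, vc]
        · simp only [cU, toNat]; omega
  | frU s =>
    by_cases h : s.val + 1 < r
    · rw [partner_frU X s h]
      refine ⟨isU_dSlot₁ X _ _, ?_, ?_⟩
      · simp [adj, adjV, vc]
      · simp only [cU, toNat, dSlot₁_val, uw_dSlot₁]; ring
    · rw [partner_frU_last X s h]
      have hs : s.val + 1 = r := by have := s.isLt; omega
      refine ⟨rfl, ?_, ?_⟩
      · simp [adj, adjV, vc]; omega
      · simp only [cU, toNat]
        have e1 : (2 * r + 1) * (s.val + 1) = (2 * r + 1) * r := by rw [hs]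
        rw [e1]; ring
  | slot s i t =>
    by_cases ht : t.val % 2 = 0
    · have htu := eq_uSlot₁_of_isU X hx ht
      subst htu
      by_cases h : s.val + 1 < r
      · rw [partner_slot_even X s i _ ht h]
        refine ⟨isU_dSlot₂ X _ _, ?_, ?_⟩
        · simp [adj, adjV, vc]
        · simp only [cU, toNat, dSlot₂_val, uw_dSlot₂, uSlot₁_val, uw_uSlot₁]; ring
      · rw [partner_slot_even_last X s i _ ht h]
        have hs : s.val + 1 = r := by have := s.isLt; omega
        refine ⟨rfl, ?_, ?_⟩
        · simp [adj, adjV, vc]; omega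
        · simp only [cU, toNat, uSlot₁_val, uw_uSlot₁]
          have e1 : (2 * r + 1) * (s.val + 1) = (2 * r + 1) * r := by rw [hs]
          rw [e1]; ring
    · have htu := eq_uSlot₂_of_isU X hx (by omega)
      subst htu
      by_cases h : s.val + 1 < r
      · by_cases h₂ : i.val + 1 < r
        · rw [partner_slot_odd X s i _ ht h h₂]
          refine ⟨isU_dSlot₁ X _ _, ?_, ?_⟩
          · simp [adj, adjV, vc]
          · simp only [cU, toNat, dSlot₁_val, uw_dSlot₁, uSlot₂_val, uw_uSlot₂]; ring
        · rw [partner_slot_odd_frD X s i _ ht h h₂]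
          have hi : i.val + 1 = r := by have := i.isLt; omega
          refine ⟨rfl, ?_, ?_⟩
          · simp [adj, adjV, vc]; omega
          · simp only [cU, toNat, uSlot₂_val, uw_uSlot₂]
            ring_nf; omega
      · rw [partner_slot_odd_last X s i _ ht h]
        have hs : s.val + 1 = r := by have := s.isLt; omega
        refine ⟨rfl, ?_, ?_⟩
        · simp [adj, adjV, vc]; omega
        · simp only [cU, toNat, uSlot₂_val, uw_uSlot₂]
          have e1 : (2 * r + 1) * (s.val + 1) = (2 * r + 1) * r := by rw [hs]
          rw [e1]; ring
  | frD s => simp [isU] at hx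
  | post j => simp [isU] at hx
  | pad j =>
    have hj := j.isLt
    simp only [isU, decide_eq_true_eq] at hx
    have h : j.val + 1 < 2 * d := by omega
    rw [partner_pad X j h]
    refine ⟨?_, ?_, ?_⟩
    · simp only [isU, decide_eq_false_iff_not]; omega
    · simp [adj]; omega
    · simp only [cU, toNat]; omega

end QPos

variable {r d : ℕ} (X : Fin r × Fin r → Bool)

/-- the rank filter at a symbolic position, in the two spellings used by the tree's bookkeeping lemmas -/
theorem filter_lt_toFin (S : Finset (Fin (2 * half r d))) (x : QPos r d) :
    (S.filter fun i => i < x.toFin) = S.filter fun i => i.val < x.toNat := by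
  ext i; simp only [mem_filter, Fin.lt_def, QPos.toFin_val]

/-- **The FIFO pairing pops every push at its designed closer**: `design d X (x) = partner X x` for pushes `x`. -/
theorem design_toFin (x : QPos r d) (hx : QPos.isU X x = true) :
    design d X x.toFin = (QPos.partner X x).toFin := by
  obtain ⟨hpU, -, hcnt⟩ := QPos.partner_spec X x hx
  have hw : word d X x.toFin = true := by rw [word_toFin, hx]
  have hmem : x.toFin ∈ openerSet (word d X) := mem_openerSet.2 hw
  have hk : QPos.cU X x < (openerSet (word d X)).card := by
    have := card_filter_lt_lt_card hmem
    rwa [filter_lt_toFin, QPos.card_openers_lt] at this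
  have h1 : (openerSet (word d X)).orderEmbOfFin rfl ⟨QPos.cU X x, hk⟩ = x.toFin :=
    opener_eq_orderEmbOfFin hw _ (by rw [filter_lt_toFin, QPos.card_openers_lt])
  have hsum := card_openers_lt_add_card_closers_lt (word d X) (QPos.partner X x).toFin
  rw [filter_lt_toFin, QPos.card_openers_lt] at hsum
  have h2 : (closerSet (word d X)).orderEmbOfFin (QPos.balanced_word X) ⟨QPos.cU X x, hk⟩
      = (QPos.partner X x).toFin :=
    closer_eq_orderEmbOfFin (by rw [word_toFin, hpU]) _ (by
      show QPos.cU X x = _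
      simp only [QPos.toFin_val] at hsum
      omega)
  rw [design_eq_fifo, ← h1, fifo_opener, h2]

/-- **Designs are supported on the allowed arcs**: every arc `(p, design p)`, `p` an opener, lies in `allowed r d`. -/
theorem design_mem_allowed (p : Fin (2 * half r d)) (hp : p < design d X p) : (p, design d X p) ∈ allowed r d := by
  obtain ⟨x, rfl⟩ := QPos.exists_toFin_eq p
  have hx : QPos.isU X x = true := (toFin_lt_design_iff X x).1 hp
  rw [design_toFin X x hx, mem_allowed_iff]
  exact (QPos.partner_spec X x hx).2.1

/-- **Read-out, vertical pairs**: the first push of window `(s, i)` is popped at the second pop of window `(s+1, i)`. -/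
theorem design_uSlot₁ (s i : Fin r) (h : s.val + 1 < r) :
    design d X (QPos.slot s i (QPos.uSlot₁ (X (s, i)))).toFin
      = (QPos.slot ⟨_, h⟩ i (QPos.dSlot₂ (X (⟨_, h⟩, i))) : QPos r d).toFin := by
  rw [design_toFin X _ (QPos.isU_uSlot₁ X s i), QPos.partner_slot_even X s i _ (by simp) h]

/-- **Read-out, diagonal pairs**: the second push of window `(s, i)` is popped at the first pop of window
`(s+1, i+1)`. -/
theorem design_uSlot₂ (s i : Fin r) (h : s.val + 1 < r) (h₂ : i.val + 1 < r) :
    design d X (QPos.slot s i (QPos.uSlot₂ (X (s, i)))).toFin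
      = (QPos.slot ⟨_, h⟩ ⟨_, h₂⟩ (QPos.dSlot₁ (X (⟨_, h⟩, ⟨_, h₂⟩))) : QPos r d).toFin := by
  rw [design_toFin X _ (QPos.isU_uSlot₂ X s i), QPos.partner_slot_odd X s i _ (by simp) h h₂]

end Summit.ValiantsHypothesis.ValiantsHypothesis.Theorems.FifoMatching.NFPolytopeQuasiPolyXC.QueueGridFace

end
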